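import Mathlib

/-!
# (M6) RAY OSCILLATION, (M7) TRANSVERSE PAYMENT, (M9) RIDGE MINIMAX — plates t50-S of nsreg-p2 ROUND-47
«WHO HOLDS THE RIDGE» (`r47/Sketch47.lean` sha16 c5b0bf755040b563, texts VERBATIM)

Width piece for crux `EulerZoomLiouville.PowerGaugeEulerLiouville` (stmt-NavierStokesRegularity-19832), by name under
LEAD 19832 (successor of ns-typeII-p2 g13) and planner nsreg-p2 g37; seat ns-ezl-w2 g5,
`--supports stmt-NavierStokesRegularity-19832 --as helper`.

Three of the ten free-standing S lemmas that price the holders of the Bernoulli pressure ridge at a first hit of a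
slice by a climbing backward similarity orbit (ROUND-47 §1–§3):

* `rayOscillationBound` = `NsregP2.R47.RayOscillationBound` (M6): for `P ∈ C¹(ℝ³)`,
  `|P x − P 0| ≤ ‖x‖ ∫_0^1 ‖DP(t x)‖ dt` (FTC along the ray `t ↦ P (t • x)`); the pressure normalisation WITHOUT any gauge.
* `transversePayment` = `NsregP2.R47.TransversePayment` (M7): at a hit `y` (`⟪y,e⟫ = s`, `⟪V,e⟫ = −γ′s`, `‖e‖ = 1`,
  `0 < γ ≤ ½`) with similarity-Bernoulli value `½‖γy + V‖² + P + ½γ(γ−1)‖y‖² ≥ H₀`: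
  `P + ½‖V_⊥‖² ≥ H₀ + ½(γ(1−γ) − (γ′−γ)²)s² − γ⟪y_⊥, V_⊥⟫` (`y_⊥ = y − s e`, `V_⊥ = V − ⟪V,e⟫e`); pure algebra —
  the dropped term is `½γ(1−2γ)‖y_⊥‖² ≥ 0`.
* `ridgeMinimax` = `NsregP2.R47.RidgeMinimax` (M9): the real inequality behind `β⁗ = 14/9 + ρ`: if
  `½(γ(1−γ) − x²) − ε ≤ √(R/2)(√((γ²−γx+x²)/3) + ½√(σ/2)) + E/4` with `2/5 ≤ γ ≤ ½` and `x, σ, R, E, ε ≥ 0`, then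
  `2γ − 8γ²/9 − 4ε ≤ 2(γ+x)² + σ + R + E` (two completed squares `2(√(σ/2) − √(R/2)/2)²`,
  `(3/2)(√(R/2) − (4/3)√((γ²−γx+x²)/3))²` and `x(44γ − 8x)/9 ≥ 0` for `x ≤ 11γ/2`; for `x > 11γ/2` already
  `2(γ+x)² ≥ 2γ`).

Each statement is proved in a working form (`…_of`) and then binder-for-binder as the planner's `Prop` text
(`EuclideanSpace ℝ (Fin 3)` written out for the sketch's `abbrev E3`).

HONEST FRAMING: elementary real analysis / algebra on the MODEL lattice of crux E; proves nothing about the crux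
(19832 OPEN), about `Sig.stub_selfSimilarC2Needle`, about THEOREM K⁗, or about Navier–Stokes regularity; no hard core is
touched. [folklore]
-/

noncomputable section

open Set Filter Topology Metric Function MeasureTheory Real
open scoped RealInnerProductSpace NNReal ENNReal

set_option linter.dupNamespace false

namespace Summit.NavierStokesRegularity.NavierStokesRegularity.Theorems.PowerGaugeEulerLiouville.NeedleRidge

/-! ## (M6) The ray oscillation bound -/

/-- **(M6) RAY OSCILLATION BOUND**, working form: for `P ∈ C¹(ℝ³, ℝ)` and `x ∈ ℝ³`,
`|P x − P 0| ≤ ‖x‖ · ∫_0^1 ‖DP(t • x)‖ dt` (fundamental theorem of calculus along `t ↦ P (t • x)`, whose derivative is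
`DP(t • x)[x]`, and `‖DP(t • x)[x]‖ ≤ ‖DP(t • x)‖ ‖x‖`). [folklore] -/
theorem rayOscillationBound_of {P : EuclideanSpace ℝ (Fin 3) → ℝ} (hP : ContDiff ℝ 1 P)
    (x : EuclideanSpace ℝ (Fin 3)) :
    |P x - P 0| ≤ ‖x‖ * (∫ t in (0 : ℝ)..1, ‖fderiv ℝ P (t • x)‖) := by
  have hPd : Differentiable ℝ P := hP.differentiable one_ne_zero
  have hDc : Continuous (fderiv ℝ P) := hP.continuous_fderiv one_ne_zero
  have hline : ∀ t : ℝ, HasDerivAt (fun t : ℝ => t • x) x t := fun t => by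
    simpa using (hasDerivAt_id t).smul_const x
  have hg : ∀ t : ℝ, HasDerivAt (fun t : ℝ => P (t • x)) (fderiv ℝ P (t • x) x) t := fun t =>
    ((hPd (t • x)).hasFDerivAt).comp_hasDerivAt t (hline t)
  have hDtc : Continuous fun t : ℝ => fderiv ℝ P (t • x) :=
    hDc.comp (continuous_id.smul continuous_const)
  have hgc : Continuous fun t : ℝ => fderiv ℝ P (t • x) x := hDtc.clm_apply continuous_const
  have hftc : ∫ t in (0 : ℝ)..1, fderiv ℝ P (t • x) x = P ((1 : ℝ) • x) - P ((0 : ℝ) • x) :=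
    intervalIntegral.integral_eq_sub_of_hasDerivAt (fun t _ => hg t) (hgc.intervalIntegrable _ _)
  rw [one_smul, zero_smul] at hftc
  rw [← hftc]
  calc |∫ t in (0 : ℝ)..1, fderiv ℝ P (t • x) x|
      = ‖∫ t in (0 : ℝ)..1, fderiv ℝ P (t • x) x‖ := (Real.norm_eq_abs _).symm
    _ ≤ ∫ t in (0 : ℝ)..1, ‖fderiv ℝ P (t • x) x‖ :=
        intervalIntegral.norm_integral_le_integral_norm zero_le_one
    _ ≤ ∫ t in (0 : ℝ)..1, ‖x‖ * ‖fderiv ℝ P (t • x)‖ := by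
        refine intervalIntegral.integral_mono_on zero_le_one (hgc.norm.intervalIntegrable _ _)
          ((continuous_const.mul hDtc.norm).intervalIntegrable _ _) fun t _ => ?_
        calc ‖fderiv ℝ P (t • x) x‖ ≤ ‖fderiv ℝ P (t • x)‖ * ‖x‖ := ContinuousLinearMap.le_opNorm _ _
          _ = ‖x‖ * ‖fderiv ℝ P (t • x)‖ := mul_comm _ _
    _ = ‖x‖ * ∫ t in (0 : ℝ)..1, ‖fderiv ℝ P (t • x)‖ := intervalIntegral.integral_const_mul _ _

/-- **(M6) `NsregP2.R47.RayOscillationBound`, binder-for-binder** (Sketch47 of nsreg-p2 g37, plate t50-M6): for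
`P ∈ C¹(ℝ³)`, `|P x − P 0| ≤ ‖x‖ ∫_0^1 ‖DP(t x)‖ dt`.  Use in ROUND-47: the pressure reference level on a slice is
fixed by `DP′ = −(1−γ)V − DV·W` and the ball budgets, with no gauge and no `P′ = P + C`. [folklore] -/
theorem rayOscillationBound :
    ∀ (P : EuclideanSpace ℝ (Fin 3) → ℝ), ContDiff ℝ 1 P → ∀ x : EuclideanSpace ℝ (Fin 3),
      |P x - P 0| ≤ ‖x‖ * (∫ t in (0 : ℝ)..1, ‖fderiv ℝ P (t • x)‖) :=
  fun _ hP x => rayOscillationBound_of hP x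

/-! ## (M7) The transverse payment -/

/-- **(M7) THE TRANSVERSE PAYMENT**, working form (pure algebra in `ℝ³`).  With `‖e‖ = 1`, `⟪y,e⟫ = s`,
`⟪V,e⟫ = −γ′s`, `0 < γ ≤ ½` and `H₀ ≤ ½‖γy + V‖² + P + ½γ(γ−1)‖y‖²`:
`H₀ + ½(γ(1−γ) − (γ′−γ)²)s² − γ⟪y − s e, V − ⟪V,e⟫e⟫ ≤ P + ½‖V − ⟪V,e⟫e‖²`.
Proof: `‖γy+V‖² = γ²‖y‖² + 2γ⟪y,V⟫ + ‖V‖²`, `‖V − ⟪V,e⟫e‖² = ‖V‖² − γ′²s²`,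
`⟪y − s e, V − ⟪V,e⟫e⟫ = ⟪y,V⟫ + γ′s²`; the difference of the two sides is then the hypothesis' slack plus
`½γ(1−2γ)(‖y‖² − s²) ≥ 0` (`s² ≤ ‖y‖²` by Cauchy–Schwarz). [folklore] -/
theorem transversePayment_of {y V e : EuclideanSpace ℝ (Fin 3)} {s γ γ' H0 P : ℝ} (he : ‖e‖ = 1)
    (hy : ⟪y, e⟫ = s) (hV : ⟪V, e⟫ = -(γ' * s)) (hγ : 0 < γ) (hγ2 : γ ≤ 1 / 2)
    (hH : H0 ≤ (1 / 2) * ‖γ • y + V‖ ^ 2 + P + γ * (γ - 1) / 2 * ‖y‖ ^ 2) :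
    H0 + (1 / 2) * (γ * (1 - γ) - (γ' - γ) ^ 2) * s ^ 2 - γ * ⟪y - s • e, V - ⟪V, e⟫ • e⟫ ≤
      P + (1 / 2) * ‖V - ⟪V, e⟫ • e‖ ^ 2 := by
  have hee : ⟪e, e⟫ = 1 := by rw [real_inner_self_eq_norm_sq, he, one_pow]
  have heV : ⟪e, V⟫ = -(γ' * s) := by rw [real_inner_comm, hV]
  have h1 : ‖γ • y + V‖ ^ 2 = γ ^ 2 * ‖y‖ ^ 2 + 2 * γ * ⟪y, V⟫ + ‖V‖ ^ 2 := by
    rw [norm_add_sq_real, norm_smul, Real.norm_eq_abs, abs_of_pos hγ, real_inner_smul_left]; ring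
  have h2 : ‖V - ⟪V, e⟫ • e‖ ^ 2 = ‖V‖ ^ 2 - (γ' * s) ^ 2 := by
    rw [norm_sub_sq_real, real_inner_smul_right, norm_smul, Real.norm_eq_abs, he, mul_one, sq_abs, hV]
    ring
  have h3 : ⟪y - s • e, V - ⟪V, e⟫ • e⟫ = ⟪y, V⟫ + γ' * s ^ 2 := by
    simp only [inner_sub_left, inner_sub_right, real_inner_smul_left, real_inner_smul_right, hV, hy, hee,
      heV]
    ring
  have h4 : s ^ 2 ≤ ‖y‖ ^ 2 := by
    have h := abs_real_inner_le_norm y e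
    rw [hy, he, mul_one] at h
    have h0 : 0 ≤ ‖y‖ := norm_nonneg _
    rw [← sq_abs s]
    exact pow_le_pow_left₀ (abs_nonneg s) h 2
  rw [h1] at hH
  rw [h2, h3]
  nlinarith [mul_nonneg (mul_nonneg hγ.le (by linarith : (0 : ℝ) ≤ 1 - 2 * γ)) (sub_nonneg.2 h4)]

/-- **(M7) `NsregP2.R47.TransversePayment`, binder-for-binder** (Sketch47 of nsreg-p2 g37, plate t50-M7): the
Bernoulli bookkeeping at a hit, transverse form — `P + ½‖V_⊥‖² ≥ H₀ + ½(γ(1−γ) − (γ′−γ)²)s² − γ⟪y_⊥, V_⊥⟫`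
(`y_⊥ = y − s e`, `V_⊥ = V − ⟪V,e⟫e`).  In ROUND-47 the left side is exactly the `δ → 0` value of the identity's
`⨍_{S_δ}(p + v_r²)`. [folklore] -/
theorem transversePayment :
    ∀ (y V e : EuclideanSpace ℝ (Fin 3)) (s γ γ' H0 P : ℝ), ‖e‖ = 1 → ⟪y, e⟫ = s → ⟪V, e⟫ = -(γ' * s) →
      0 < γ → γ ≤ 1 / 2 →
      H0 ≤ (1 / 2) * ‖γ • y + V‖ ^ 2 + P + γ * (γ - 1) / 2 * ‖y‖ ^ 2 →
      H0 + (1 / 2) * (γ * (1 - γ) - (γ' - γ) ^ 2) * s ^ 2 - γ * ⟪y - s • e, V - ⟪V, e⟫ • e⟫ ≤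
        P + (1 / 2) * ‖V - ⟪V, e⟫ • e‖ ^ 2 :=
  fun _ _ _ _ _ _ _ _ he hy hV hγ hγ2 hH => transversePayment_of he hy hV hγ hγ2 hH

/-! ## (M9) The ridge minimax -/

/-- **(M9) THE RIDGE MINIMAX**, working form.  For `2/5 ≤ γ` (the upper bound `γ ≤ ½` of the plate is not used) and
`x, σ, R, E, ε ≥ 0`: if
`½(γ(1−γ) − x²) − ε ≤ √(R/2)·(√((γ²−γx+x²)/3) + ½√(σ/2)) + E/4` then `2γ − 8γ²/9 − 4ε ≤ 2(γ+x)² + σ + R + E`.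
Proof: with `A = √(R/2)`, `B = √(σ/2)`, `M = √((γ²−γx+x²)/3)` the claim minus four times the hypothesis is
`0 ≤ 4γx + 8γ²/9 + 2A² + 2B² − 2AB − 4AM = 2(B − A/2)² + (3/2)(A − 4M/3)² + x(44γ − 8x)/9`, non-negative for
`x ≤ 11γ/2`; for `x > 11γ/2`, `2(γ+x)² ≥ (169/2)γ² ≥ 2γ`.  Equality: `x = 0`, `R = 32γ²/27`, `σ = 8γ²/27`. [folklore] -/
theorem ridgeMinimax_of {γ x σ R E ε : ℝ} (hγ1 : 2 / 5 ≤ γ) (hx : 0 ≤ x) (hσ : 0 ≤ σ) (hR : 0 ≤ R)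
    (hE : 0 ≤ E) (hε : 0 ≤ ε)
    (h : (1 / 2) * (γ * (1 - γ) - x ^ 2) - ε ≤
        Real.sqrt (R / 2) * (Real.sqrt ((γ ^ 2 - γ * x + x ^ 2) / 3) + (1 / 2) * Real.sqrt (σ / 2)) + E / 4) :
    2 * γ - 8 / 9 * γ ^ 2 - 4 * ε ≤ 2 * (γ + x) ^ 2 + σ + R + E := by
  set A := Real.sqrt (R / 2) with hA
  set M := Real.sqrt ((γ ^ 2 - γ * x + x ^ 2) / 3) with hM
  set B := Real.sqrt (σ / 2) with hB
  have hA0 : 0 ≤ A := Real.sqrt_nonneg _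
  have hM0 : 0 ≤ M := Real.sqrt_nonneg _
  have hB0 : 0 ≤ B := Real.sqrt_nonneg _
  have hγ0 : 0 ≤ γ := by linarith
  have hA2 : A ^ 2 = R / 2 := Real.sq_sqrt (by positivity)
  have hB2 : B ^ 2 = σ / 2 := Real.sq_sqrt (by positivity)
  have hq : 0 ≤ γ ^ 2 - γ * x + x ^ 2 := by nlinarith [sq_nonneg (γ - x), mul_nonneg hγ0 hx]
  have hM2 : M ^ 2 = (γ ^ 2 - γ * x + x ^ 2) / 3 := Real.sq_sqrt (by positivity)
  rcases le_or_gt x (11 / 2 * γ) with hxs | hxl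
  · nlinarith [sq_nonneg (B - A / 2), sq_nonneg (A - 4 * M / 3),
      mul_nonneg hx (by linarith : (0 : ℝ) ≤ 44 * γ - 8 * x)]
  · have h1 : 0 ≤ (x + γ - 13 / 2 * γ) * (x + γ + 13 / 2 * γ) := mul_nonneg (by linarith) (by linarith)
    have h2 : 0 ≤ γ * (169 / 4 * γ - 1) := mul_nonneg hγ0 (by linarith)
    nlinarith [h1, h2, sq_nonneg γ]

/-- **(M9) `NsregP2.R47.RidgeMinimax`, binder-for-binder** (Sketch47 of nsreg-p2 g37, plate t50-M9): in units
`πs²/Λ`, with COLUMN share `2(γ+x)² + σ`, ROW share `R` and BLOCK + DIAGONAL share `E` of the slice Frobenius energy,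
the per-height inequality (hypothesis, slack `ε`) forces the count `T̃ = 2(γ+x)² + σ + R + E ≥ 2γ − 8γ²/9 − 4ε`
`= (14/9 + ρ − 4ε/(2γ²))·2γ²` (`1/γ = 2 + ρ`) that THEOREM K⁗ feeds to the K″ machine. [folklore] -/
theorem ridgeMinimax :
    ∀ (γ x σ R E ε : ℝ), 2 / 5 ≤ γ → γ ≤ 1 / 2 → 0 ≤ x → 0 ≤ σ → 0 ≤ R → 0 ≤ E → 0 ≤ ε →
      (1 / 2) * (γ * (1 - γ) - x ^ 2) - ε ≤
          Real.sqrt (R / 2) * (Real.sqrt ((γ ^ 2 - γ * x + x ^ 2) / 3) + (1 / 2) * Real.sqrt (σ / 2)) + E / 4 →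
      2 * γ - 8 / 9 * γ ^ 2 - 4 * ε ≤ 2 * (γ + x) ^ 2 + σ + R + E :=
  fun _ _ _ _ _ _ hγ1 _ hx hσ hR hE hε h => ridgeMinimax_of hγ1 hx hσ hR hE hε h

end Summit.NavierStokesRegularity.NavierStokesRegularity.Theorems.PowerGaugeEulerLiouville.NeedleRidge

end
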